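import Literature.Topology.FourManifolds.InteriorManifold
import Literature.Topology.FourManifolds.ChartTransport
import Literature.Topology.FourManifolds.GluingUniqueness
import Literature.Topology.FourManifolds.SmoothOrientation
import HarnessLib

/-!
# Discs in a manifold with corners lie in the interior

Topic `Literature/Topology/FourManifolds` (general differential topology; bricks [A0], [A2], [A3]
of the discharge of `Literature.Topology.FourManifolds.nonempty_diffeomorph_of_isOrientedConnectedSum`
at arbitrary models, see `ConnectedSumUniquenessProofs.lean`).

Let `M` be a `C^∞` manifold modelled on an arbitrary real model with corners
`I : ModelWithCorners ℝ E H` over a finite-dimensional space `E`, and let `i : E → M` be a *disc*: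
a smooth embedding of the model vector space (Mathlib `Manifold.IsSmoothEmbedding 𝓘(ℝ, E) I ∞ i`;
Mathlib's immersions are linear in charts of the maximal atlases). We prove:

* `Literature.Topology.FourManifolds.isInteriorPoint_of_isSmoothEmbedding_disc`: every point `i y`
  is an *interior* point of `M` (in the immersion charts `i` reads as a linear isomorphism on an
  open set, whose image is open in `E` and contained in `range I`); the maximal-atlas form of
  Mathlib's invariance of the interior (`ModelWithCorners.isInteriorPoint_iff_of_mem_atlas`) is
  a private copy of the tree's `mem_interior_extend_target_of_mem_maximalAtlas`
  (`BallGluingCharts.lean`, not imported here).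
* `Literature.Topology.FourManifolds.isOpen_range_disc`, `…contMDiffOn_symm_disc`: the range of a
  disc is open and the inverse is `C^∞` on it (for *any* target model `I`; the boundaryless case
  is `exists_chart_of_isSmoothEmbedding` of `ChartTransport.lean`).
* `Literature.Topology.FourManifolds.InteriorManifold.lift`: the factorisation `î : E → InteriorManifold I M`
  of `i` through the boundaryless interior manifold (`InteriorManifold.lean`), and
  `…isSmoothEmbedding_lift_disc`: `î` is a smooth embedding for the boundaryless models
  `𝓘(ℝ, E)`, `𝓘(ℝ, E)`.
* `Literature.Topology.FourManifolds.SmoothOrientation.interior`: the orientation of the interior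
  manifold induced by an orientation of `M` (the charts of the interior are the extended charts
  of `M`, so the tangent coordinate changes agree, `InteriorManifold.tangentCoordChange_eq`), with
  `InteriorManifold.mfderiv_comp_val` (the differential of a map into the interior is that of the
  underlying map into `M`) and the transfer
  `…isOrientationPreserving_lift_iff`: `î` preserves `(o₀, oM.interior)` iff `i` preserves
  `(o₀, oM)`.

These are the formal bookkeeping steps of "a disc in `M` lies in `Int M`, where the theory of
boundaryless manifolds applies" (Kosinski, *Differential Manifolds* (1993), VI.1: connected sums
are taken along discs in `Int Mᵢ`; Bröcker–Jänich (1982), (13.3)). Everything is proved; no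
named facts.

## References

* A. Kosinski, *Differential Manifolds*, Academic Press (1993), Ch. VI §1. [Kosinski1993]
* T. Bröcker, K. Jänich, *Introduction to Differential Topology*, CUP (1982), (13.3).
  [BrockerJanich1982]
-/

open scoped Manifold ContDiff Topology
open Set Function Filter OpenPartialHomeomorph

noncomputable section

namespace Literature.Topology.FourManifolds

/-! ### Invariance of the interior for charts of the maximal atlas -/

section MaximalAtlas

variable {E H : Type*} [NormedAddCommGroup E] [NormedSpace ℝ E] [TopologicalSpace H]
  {I : ModelWithCorners ℝ E H} {M : Type*} [TopologicalSpace M] [ChartedSpace H M]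
  {n : WithTop ℕ∞}

/-- **Invariance of the interior, maximal-atlas form.** For two charts `e`, `e'` of the maximal
`C^n` atlas (`n ≠ 0`) around `x`, if `e` sends `x` into the interior of its (extended) target,
so does `e'`. This is Mathlib's `ModelWithCorners.mem_interior_range_of_mem_interior_range_of_mem_atlas`
with `atlas` replaced by `maximalAtlas` (its proof only uses the maximal atlas: the coordinate
change is a local diffeomorphism, and a differentiable map with surjective differential cannot
send an interior point of its domain to a boundary point of the closed convex set `range I`).
A `private` copy: the tree has the same statement in `BallGluingCharts.lean` (and the corollary
below in `SPC4HandleChainProofs.lean`), whose imports are unrelated to this file. [folklore] -/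
private theorem memInteriorExtendTarget_aux (hn : n ≠ 0)
    {e e' : OpenPartialHomeomorph M H} (he : e ∈ IsManifold.maximalAtlas I n M)
    (he' : e' ∈ IsManifold.maximalAtlas I n M) {x : M} (hex : x ∈ e.source)
    (hex' : x ∈ e'.source) (hx : e.extend I x ∈ interior (e.extend I).target) :
    e'.extend I x ∈ interior (e'.extend I).target := by
  let φ := I.extendCoordChange e e'
  have hφ : ContDiffOn ℝ n φ φ.source := I.contDiffOn_extendCoordChange he he'
  suffices h : Function.Surjective (fderivWithin ℝ φ φ.source (e.extend I x)) →
      e'.extend I x ∈ interior (range I) by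
    refine e'.mem_interior_extend_target (by simp [hex']) <| h ?_
    exact (I.isInvertible_fderivWithin_extendCoordChange hn he he' <| by simp [hex, hex']).surjective
  intro hφx'
  have hφx : φ.source ∈ 𝓝 (e.extend I x) := by
    simp_rw [φ, ModelWithCorners.extendCoordChange, PartialEquiv.trans_source,
      PartialEquiv.symm_source, Filter.inter_mem_iff, mem_interior_iff_mem_nhds.1 hx, true_and,
      e'.extend_source]
    exact e.extend_preimage_mem_nhds hex <| e'.open_source.mem_nhds hex'
  rw [fderivWithin_of_mem_nhds hφx] at hφx'
  rw [show e'.extend I x = φ (e.extend I x) by simp [φ, hex]]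
  replace hφ := (hφ.differentiableOn hn).differentiableAt hφx
  exact hφ.mem_interior_convex_of_surjective_fderiv hφx I.convex_range I.isClosed_range
    I.nonempty_interior (φ.mapsTo.mono_right <| by simp [φ, inter_assoc]) hφx'

/-- A point sent by some chart of the maximal `C^n` atlas (`n ≠ 0`) into the interior of
`range I` is an interior point of `M` (`private` copy, see above). [folklore] -/
private theorem isInteriorPoint_aux [IsManifold I n M] (hn : n ≠ 0)
    {e : OpenPartialHomeomorph M H}
    (he : e ∈ IsManifold.maximalAtlas I n M) {x : M} (hex : x ∈ e.source)
    (hx : e.extend I x ∈ interior (range I)) : I.IsInteriorPoint x := by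
  rw [ModelWithCorners.isInteriorPoint_iff]
  have hx' : e.extend I x ∈ interior (e.extend I).target :=
    e.mem_interior_extend_target (by simp [hex]) (by simpa [e.extend_coe] using hx)
  exact memInteriorExtendTarget_aux hn he
    (IsManifold.chart_mem_maximalAtlas x) hex (mem_chart_source H x) hx'

end MaximalAtlas

/-! ### Discs: equidimensional smooth embeddings of the model vector space -/

section Disc

variable {E : Type*} [NormedAddCommGroup E] [NormedSpace ℝ E] [FiniteDimensional ℝ E]
  {H : Type*} [TopologicalSpace H] {I : ModelWithCorners ℝ E H}
  {M : Type*} [TopologicalSpace M] [ChartedSpace H M]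
  {i : E → M}

/-- The linear model `u ↦ equiv (u, 0)` of an immersion between manifolds modelled on the same
finite-dimensional space is a linear *isomorphism* (injective, hence surjective). [folklore] -/
theorem bijective_immersionAt_equiv_inl {n : ℕ∞ω} {y : E}
    (h : Manifold.IsImmersionAt 𝓘(ℝ, E) I n i y) :
    Function.Bijective (fun u : E => h.equiv (u, 0)) := by
  have hinj : Function.Injective (fun u : E => h.equiv (u, 0)) :=
    h.equiv.injective.comp (Prod.mk_left_injective 0)
  let l : E →ₗ[ℝ] E := h.equiv.toLinearEquiv.toLinearMap ∘ₗ LinearMap.inl ℝ E h.complement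
  have hl : ⇑l = fun u : E => h.equiv (u, 0) := rfl
  rw [← hl] at hinj ⊢
  exact ⟨hinj, (LinearMap.injective_iff_surjective_of_finrank_eq_finrank rfl).1 hinj⟩

omit [FiniteDimensional ℝ E] in
/-- In the charts of an immersion `i : E → M` at `y`, `ψ (i a) = equiv (φ a, 0)` on the source of
the domain chart. [folklore] -/
theorem extend_codChart_apply_disc {n : ℕ∞ω} {y : E}
    (h : Manifold.IsImmersionAt 𝓘(ℝ, E) I n i y) {a : E} (ha : a ∈ h.domChart.source) :
    h.codChart.extend I (i a) = h.equiv (h.domChart a, 0) := by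
  have h1 : h.domChart.extend 𝓘(ℝ, E) a ∈ (h.domChart.extend 𝓘(ℝ, E)).target :=
    (h.domChart.extend 𝓘(ℝ, E)).map_source (by rwa [extend_source])
  have h2 := h.writtenInCharts h1
  simp only [comp_apply] at h2
  rw [h.domChart.extend_left_inv ha] at h2
  simpa using h2

variable [IsManifold I ∞ M]

/-- **A disc lies in the interior.** Every point in the image of a smooth embedding
`i : E → M` of the (boundaryless) model vector space is an interior point of the manifold with
corners `M`: in the immersion charts `i` reads as a linear isomorphism on the open set
`φ.target`, whose image is an open subset of `E` contained in `range I`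
(Kosinski (1993), VI.1: discs for connected sums are taken in `Int M`). [folklore] -/
theorem isInteriorPoint_of_isSmoothEmbedding_disc (hi : Manifold.IsSmoothEmbedding 𝓘(ℝ, E) I ∞ i)
    (y : E) : I.IsInteriorPoint (i y) := by
  have h : Manifold.IsImmersionAt 𝓘(ℝ, E) I ∞ i y := hi.isImmersion.isImmersionAt y
  set φ := h.domChart
  set ψ := h.codChart
  set l : E → E := fun u => h.equiv (u, 0) with hl
  have hlo : IsOpenMap l := by
    let L : E →ₗ[ℝ] E := h.equiv.toLinearEquiv.toLinearMap ∘ₗ LinearMap.inl ℝ E h.complement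
    have hL : ⇑L = l := rfl
    rw [← hL]
    exact L.isOpenMap_of_finiteDimensional (hL ▸ (bijective_immersionAt_equiv_inl h).2)
  refine isInteriorPoint_aux (by simp) h.codChart_mem_maximalAtlas
    h.mem_codChart_source ?_
  -- `ψ (i y)` lies in the open set `l '' φ.target ⊆ range I`
  have hsub : l '' φ.target ⊆ range I := by
    rintro _ ⟨u, hu, rfl⟩
    have hu' : u ∈ (φ.extend 𝓘(ℝ, E)).target := by simpa [extend_target] using hu
    have h3 := h.writtenInCharts hu'
    simp only [comp_apply] at h3
    have h4 : l u = ψ.extend I (i ((φ.extend 𝓘(ℝ, E)).symm u)) := by rw [h3]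
    rw [h4, extend_coe]
    exact mem_range_self _
  have hmem : ψ.extend I (i y) ∈ l '' φ.target :=
    ⟨φ y, φ.map_source h.mem_domChart_source,
      (extend_codChart_apply_disc h h.mem_domChart_source).symm⟩
  exact interior_maximal hsub (hlo _ φ.open_target) hmem

omit [IsManifold I ∞ M] in
/-- The range of a disc `i : E → M` is open (invariance of domain for equidimensional immersions,
`Manifold.IsSmoothEmbedding.isOpenMap_of_finrank_eq`). [folklore] -/
theorem isOpenMap_disc (hi : Manifold.IsSmoothEmbedding 𝓘(ℝ, E) I ∞ i) : IsOpenMap i :=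
  Manifold.IsSmoothEmbedding.isOpenMap_of_finrank_eq hi rfl

omit [IsManifold I ∞ M] in
/-- A disc `i : E → M` is an open embedding. [folklore] -/
theorem isOpenEmbedding_disc (hi : Manifold.IsSmoothEmbedding 𝓘(ℝ, E) I ∞ i) :
    Topology.IsOpenEmbedding i :=
  .of_continuous_injective_isOpenMap hi.contMDiff.continuous hi.isEmbedding.injective
    (isOpenMap_disc hi)

omit [IsManifold I ∞ M] in
/-- **The inverse of a disc is smooth on its range**, for an arbitrary target model `I` (descent
of smoothness along the open immersion `i`, `contMDiffAt_of_comp_isImmersionAt`). [folklore] -/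
theorem contMDiffOn_symm_disc (hi : Manifold.IsSmoothEmbedding 𝓘(ℝ, E) I ∞ i) :
    ContMDiffOn I 𝓘(ℝ, E) ∞ ((isOpenEmbedding_disc hi).toOpenPartialHomeomorph i).symm
      (range i) := by
  rintro _ ⟨y, rfl⟩
  refine (contMDiffAt_of_comp_isImmersionAt (IQ := 𝓘(ℝ, E)) (g := id)
    (hi.isImmersion.isImmersionAt y) (isOpenMap_disc hi) contMDiffAt_id fun a => ?_).contMDiffWithinAt
  exact (isOpenEmbedding_disc hi).toOpenPartialHomeomorph_left_inv

end Disc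

/-! ### Factorisation of a disc through the interior manifold -/

namespace InteriorManifold

variable {E : Type*} [NormedAddCommGroup E] [NormedSpace ℝ E]
  {H : Type*} [TopologicalSpace H] {I : ModelWithCorners ℝ E H}
  {M : Type*} [TopologicalSpace M] [ChartedSpace H M]

/-- A map into `M` with values in the interior, as a map into the interior manifold
`InteriorManifold I M`. [folklore] -/
def lift {X : Type*} (f : X → M) (hf : ∀ x, I.IsInteriorPoint (f x)) (x : X) :
    InteriorManifold I M :=
  ⟨f x, hf x⟩

/-- The underlying point of `lift f hf x` is `f x`. [folklore] -/
@[simp] theorem lift_val {X : Type*} (f : X → M) (hf : ∀ x, I.IsInteriorPoint (f x)) (x : X) :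
    (lift f hf x).val = f x := rfl

/-- `val ∘ lift f hf = f`. [folklore] -/
theorem val_comp_lift {X : Type*} (f : X → M) (hf : ∀ x, I.IsInteriorPoint (f x)) :
    val ∘ lift f hf = f := rfl

variable [IsManifold I ∞ M]

/-- A `C^n` map into `M` with values in the interior lifts to a `C^n` map into the interior
manifold. [folklore] -/
theorem contMDiff_lift {E' H' : Type*} [NormedAddCommGroup E'] [NormedSpace ℝ E']
    [TopologicalSpace H'] {J : ModelWithCorners ℝ E' H'} {X : Type*} [TopologicalSpace X]
    [ChartedSpace H' X] {n : ℕ∞} {f : X → M} (hf : ContMDiff J I n f)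
    (hf' : ∀ x, I.IsInteriorPoint (f x)) : ContMDiff J 𝓘(ℝ, E) n (lift f hf') :=
  contMDiff_iff_comp_val.2 hf

variable [FiniteDimensional ℝ E] {i : E → M}

/-- The lift of a disc to the interior manifold is an open embedding. [folklore] -/
theorem isOpenEmbedding_lift_disc (hi : Manifold.IsSmoothEmbedding 𝓘(ℝ, E) I ∞ i) :
    Topology.IsOpenEmbedding (lift i (isInteriorPoint_of_isSmoothEmbedding_disc hi)) :=
  Topology.IsOpenEmbedding.of_comp _ isOpenEmbedding_val (isOpenEmbedding_disc hi)

/-- **A disc factors through the interior as a smooth embedding.** For a smooth embedding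
`i : E → M` of the model vector space into a manifold with corners, the lift
`î : E → InteriorManifold I M` is a smooth embedding of boundaryless manifolds (models
`𝓘(ℝ, E)`): in the domain chart `chartAt (î y) ∘ î` (a partial diffeomorphism of `E`, the inverse
of `i` being smooth by `contMDiffOn_symm_disc`) and the codomain chart `chartAt (î y)` it reads
as the identity. [folklore] -/
theorem isSmoothEmbedding_lift_disc (hi : Manifold.IsSmoothEmbedding 𝓘(ℝ, E) I ∞ i) :
    Manifold.IsSmoothEmbedding 𝓘(ℝ, E) 𝓘(ℝ, E) ∞
      (lift i (isInteriorPoint_of_isSmoothEmbedding_disc hi)) := by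
  set j := lift i (isInteriorPoint_of_isSmoothEmbedding_disc hi) with hj_def
  have hjo : Topology.IsOpenEmbedding j := isOpenEmbedding_lift_disc hi
  have hjs : ContMDiff 𝓘(ℝ, E) 𝓘(ℝ, E) ∞ j := contMDiff_lift hi.contMDiff _
  -- the inverse of `j` on its range is `i⁻¹ ∘ val`, smooth
  set Ψ := hjo.toOpenPartialHomeomorph j with hΨ_def
  set Φ := (isOpenEmbedding_disc hi).toOpenPartialHomeomorph i with hΦ_def
  have hΨsymm : ∀ x ∈ range j, Ψ.symm x = Φ.symm x.val := by
    rintro _ ⟨y, rfl⟩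
    rw [hjo.toOpenPartialHomeomorph_left_inv]
    exact ((isOpenEmbedding_disc hi).toOpenPartialHomeomorph_left_inv (x := y)).symm
  have hΨs : ContMDiffOn 𝓘(ℝ, E) 𝓘(ℝ, E) ∞ Ψ.symm (range j) := by
    have h1 : ContMDiffOn 𝓘(ℝ, E) 𝓘(ℝ, E) ∞ (Φ.symm ∘ val) (range j) := by
      refine (contMDiffOn_symm_disc hi).comp contMDiff_val.contMDiffOn ?_
      rintro _ ⟨y, rfl⟩
      exact ⟨y, rfl⟩
    exact h1.congr hΨsymm
  refine ⟨?_, hjo.isEmbedding⟩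
  refine Manifold.IsImmersionOfComplement.isImmersion (F := Unit) fun y => ?_
  -- charts: `chartAt (j y) ∘ j` on `E` and `chartAt (j y)` on the interior manifold
  set c := chartAt E (j y) with hc_def
  set φ : OpenPartialHomeomorph E E := Ψ.trans c with hφ_def
  have hyφ : y ∈ φ.source := by
    simp only [hφ_def, trans_source, mem_inter_iff, mem_preimage]
    refine ⟨by simp [hΨ_def], ?_⟩
    have h := mem_chart_source E (j y)
    rw [← hc_def] at h
    simpa [hΨ_def] using h
  have hφ : φ ∈ IsManifold.maximalAtlas 𝓘(ℝ, E) ∞ E := by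
    rw [IsManifold.mem_maximalAtlas_iff_contMDiffOn]
    constructor
    · -- `φ = c ∘ j` on its source
      have h1 : ContMDiffOn 𝓘(ℝ, E) 𝓘(ℝ, E) ∞ (c ∘ j) (j ⁻¹' c.source) :=
        (contMDiffOn_chart (x := j y)).comp hjs.contMDiffOn fun _ hu => hu
      refine h1.congr_mono (fun u _ => ?_) ?_
      · simp [hφ_def, hΨ_def]
      · intro u hu
        simp only [hφ_def, trans_source, mem_inter_iff, mem_preimage] at hu
        simpa [hΨ_def] using hu.2
    · -- `φ⁻¹ = Ψ⁻¹ ∘ c⁻¹` on its target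
      have h1 : ContMDiffOn 𝓘(ℝ, E) 𝓘(ℝ, E) ∞ (Ψ.symm ∘ c.symm) φ.target := by
        refine hΨs.comp ((contMDiffOn_chart_symm (x := j y)).mono ?_) ?_
        · intro u hu
          simp only [hφ_def, trans_target, mem_inter_iff, mem_preimage] at hu
          exact hu.1
        · intro u hu
          simp only [hφ_def, trans_target, mem_inter_iff, mem_preimage] at hu
          have h2 : c.symm u ∈ Ψ.target := hu.2
          simpa [hΨ_def] using h2
      exact h1.congr fun u _ => by simp [hφ_def]
  refine Manifold.IsImmersionAtOfComplement.mk_of_continuousAt (hjs.continuous.continuousAt)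
    (.prodUnique ℝ E Unit) φ c hyφ (mem_chart_source E (j y)) hφ
    (IsManifold.chart_mem_maximalAtlas (j y)) ?_
  intro u hu
  have hu' : u ∈ φ.target := by simpa [extend_target] using hu
  have h1 : φ (φ.symm u) = u := φ.right_inv hu'
  have h2 : φ (φ.symm u) = c (j (φ.symm u)) := by simp [hφ_def, hΨ_def]
  simp only [comp_apply, extend_coe, extend_coe_symm, modelWithCornersSelf_coe,
    modelWithCornersSelf_coe_symm, id_eq, ContinuousLinearEquiv.prodUnique_apply]
  rw [← h2, h1]

/-! ### Tangent coordinate changes, differentials and orientations of the interior -/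

omit [FiniteDimensional ℝ E] in
/-- **The tangent coordinate changes of the interior manifold are those of `M`.** The charts of
`InteriorManifold I M` are the extended charts of `M` restricted to interior points, where
`range I` is a neighbourhood, so the derivative within `range I` is the plain derivative.
[folklore] -/
theorem tangentCoordChange_eq (x y z : InteriorManifold I M)
    (hz : z ∈ (extChartAt 𝓘(ℝ, E) x).source) :
    tangentCoordChange 𝓘(ℝ, E) x y z = tangentCoordChange I x.val y.val z.val := by
  rw [tangentCoordChange_def, tangentCoordChange_def, extChartAt_apply]
  have hzs : z.val ∈ (chartAt H x.val).source := by
    rw [extChartAt_source] at hz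
    exact hz
  -- the base point is an interior point of the target of the chart at `x`
  have hp : extChartAt I x.val z.val ∈ interior (extChartAt I x.val).target :=
    (I.isInteriorPoint_iff_of_mem_atlas (n := ∞) (by simp) (chart_mem_atlas H x.val) hzs).1
      z.property
  have hpo : interior (extChartAt I x.val).target ∈ 𝓝 (extChartAt I x.val z.val) :=
    isOpen_interior.mem_nhds hp
  have hrange : range I ∈ 𝓝 (extChartAt I x.val z.val) :=
    Filter.mem_of_superset hpo (interior_subset.trans (extChartAt_target_subset_range x.val))
  -- the two transition maps agree near the base point
  have hsub : interior (extChartAt I x.val).target ⊆ (extChartAt 𝓘(ℝ, E) x).target := by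
    rw [extChartAt_target, _root_.extChartAt_target, interior_inter]
    exact inter_subset_inter interior_subset Subset.rfl
  have hev : (extChartAt 𝓘(ℝ, E) y ∘ (extChartAt 𝓘(ℝ, E) x).symm) =ᶠ[𝓝 (extChartAt I x.val z.val)]
      (extChartAt I y.val ∘ (extChartAt I x.val).symm) := by
    filter_upwards [hpo] with u hu
    simp only [comp_apply, extChartAt_apply]
    rw [extChartAt_symm_apply_val x (hsub hu)]
  rw [modelWithCornersSelf_coe, range_id, fderivWithin_univ, fderivWithin_of_mem_nhds hrange,
    hev.fderiv_eq]

section MFDeriv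

variable {E' H' : Type*} [NormedAddCommGroup E'] [NormedSpace ℝ E'] [TopologicalSpace H']
  {J : ModelWithCorners ℝ E' H'} {N : Type*} [TopologicalSpace N] [ChartedSpace H' N]

omit [FiniteDimensional ℝ E] in
/-- A map into the interior manifold is differentiable iff it is differentiable as a map into
`M` (same written expression in extended charts). [folklore] -/
theorem mdifferentiableAt_iff_comp_val {g : N → InteriorManifold I M} {x : N} :
    MDifferentiableAt J 𝓘(ℝ, E) g x ↔ MDifferentiableAt J I (val ∘ g) x := by
  rw [mdifferentiableAt_iff, mdifferentiableAt_iff, isInducing_val.continuousAt_iff]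
  have : writtenInExtChartAt J 𝓘(ℝ, E) x g = writtenInExtChartAt J I x (val ∘ g) := by
    ext u
    simp only [writtenInExtChartAt, comp_apply, extChartAt_apply]
  rw [this]

omit [FiniteDimensional ℝ E] in
/-- **The differential of a map into the interior manifold is the differential of the underlying
map into `M`** (both are the derivative of the same written expression, the extended charts of
the interior being those of `M`). [folklore] -/
theorem mfderiv_eq_mfderiv_comp_val (g : N → InteriorManifold I M) (x : N) :
    mfderiv J 𝓘(ℝ, E) g x = mfderiv J I (val ∘ g) x := by
  have hw : writtenInExtChartAt J 𝓘(ℝ, E) x g = writtenInExtChartAt J I x (val ∘ g) := by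
    ext u
    simp only [writtenInExtChartAt, comp_apply, extChartAt_apply]
  by_cases hd : MDifferentiableAt J 𝓘(ℝ, E) g x
  · have hd' : MDifferentiableAt J I (val ∘ g) x := mdifferentiableAt_iff_comp_val.1 hd
    ext v
    simp only [mfderiv, hd, hd', if_true, hw]
  · have hd' : ¬ MDifferentiableAt J I (val ∘ g) x := fun h => hd (mdifferentiableAt_iff_comp_val.2 h)
    ext v
    simp only [mfderiv, hd, hd', if_false]
    rfl

end MFDeriv

end InteriorManifold

/-! ### The induced orientation of the interior manifold -/

section Orientation

open Module

variable {E : Type*} [NormedAddCommGroup E] [NormedSpace ℝ E]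
  {H : Type*} [TopologicalSpace H] {I : ModelWithCorners ℝ E H}
  {M : Type*} [TopologicalSpace M] [ChartedSpace H M] [IsManifold I ∞ M]

/-- **The orientation of the interior manifold induced by an orientation of `M`**: at the
interior point `x` it is the orientation of `M` at `x`. Local constancy transfers because the
tangent coordinate changes of `InteriorManifold I M` are those of `M`
(`InteriorManifold.tangentCoordChange_eq`). (Hirsch, *Differential Topology* (1976), §4.4: an
open submanifold of an oriented manifold is oriented.) [folklore] -/
def SmoothOrientation.interior (o : SmoothOrientation I M) :
    SmoothOrientation 𝓘(ℝ, E) (InteriorManifold I M) where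
  toFun x := o x.val
  eventually_eq_iff' x := by
    have h := o.eventually_eq_iff x.val
    filter_upwards [InteriorManifold.continuous_val.continuousAt.eventually h] with y hy
    rw [InteriorManifold.tangentCoordChange_eq y x y (mem_extChartAt_source y)]
    exact hy

/-- The induced orientation of the interior at `x` is the orientation of `M` at `x`.
[folklore] -/
@[simp] theorem SmoothOrientation.interior_apply (o : SmoothOrientation I M)
    (x : InteriorManifold I M) : o.interior x = o x.val := rfl

/-- Passing to the interior commutes with reversing the orientation. [folklore] -/
@[simp] theorem SmoothOrientation.interior_neg (o : SmoothOrientation I M) :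
    (-o).interior = -o.interior := rfl

variable {E' : Type*} {H' : Type*} [TopologicalSpace H'] {J : ModelWithCorners ℝ E H'}
  {N : Type*} [TopologicalSpace N] [ChartedSpace H' N] [IsManifold J 1 N]

/-- **A map into the interior manifold preserves orientation iff the underlying map into `M`
does** (same values of the orientations, same differentials,
`InteriorManifold.mfderiv_eq_mfderiv_comp_val`). [folklore] -/
theorem isOrientationPreserving_interior_iff {oN : SmoothOrientation J N}
    {oM : SmoothOrientation I M} {g : N → InteriorManifold I M} :
    IsOrientationPreserving oN oM.interior g ↔
      IsOrientationPreserving oN oM (InteriorManifold.val ∘ g) := by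
  refine forall_congr' fun x => ?_
  rw [InteriorManifold.mfderiv_eq_mfderiv_comp_val g x]
  rfl

/-- A map into the interior manifold reverses orientation iff the underlying map into `M` does.
[folklore] -/
theorem isOrientationReversing_interior_iff {oN : SmoothOrientation J N}
    {oM : SmoothOrientation I M} {g : N → InteriorManifold I M} :
    IsOrientationReversing oN oM.interior g ↔
      IsOrientationReversing oN oM (InteriorManifold.val ∘ g) := by
  rw [isOrientationReversing_iff, isOrientationReversing_iff, ← SmoothOrientation.interior_neg]
  exact isOrientationPreserving_interior_iff

/-- **The lift of a disc preserves orientation iff the disc does**: for `i : E → M` with values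
in the interior and a constant orientation `o₀` of `E`, the lift
`InteriorManifold.lift i _ : E → InteriorManifold I M` preserves `(o₀, oM.interior)` iff `i`
preserves `(o₀, oM)`. [folklore] -/
theorem isOrientationPreserving_lift_iff {oM : SmoothOrientation I M} {i : E → M}
    (hi : ∀ y, I.IsInteriorPoint (i y)) {o₀ : Orientation ℝ E (Fin (finrank ℝ E))} :
    IsOrientationPreserving (SmoothOrientation.modelSpace o₀) oM.interior
        (InteriorManifold.lift i hi) ↔
      IsOrientationPreserving (SmoothOrientation.modelSpace o₀) oM i :=
  isOrientationPreserving_interior_iff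

/-- The lift of a disc reverses orientation iff the disc does. [folklore] -/
theorem isOrientationReversing_lift_iff {oM : SmoothOrientation I M} {i : E → M}
    (hi : ∀ y, I.IsInteriorPoint (i y)) {o₀ : Orientation ℝ E (Fin (finrank ℝ E))} :
    IsOrientationReversing (SmoothOrientation.modelSpace o₀) oM.interior
        (InteriorManifold.lift i hi) ↔
      IsOrientationReversing (SmoothOrientation.modelSpace o₀) oM i :=
  isOrientationReversing_interior_iff

end Orientation

end Literature.Topology.FourManifolds
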